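import Summits.ValiantsHypothesis.ValiantsHypothesis.Theorems.BarrierLeverChowThinRowsLeaveTwoOut
import Summits.ValiantsHypothesis.ValiantsHypothesis.Theorems.BarrierLeverChowThinRowsScaleChoice
import Summits.ValiantsHypothesis.ValiantsHypothesis.Theorems.BarrierLeverChowThinRowsSubcubeBasis

/-!
# Route BarrierLever — item `ChowHitsThinRowPartitionMinors` (stmt-ValiantsHypothesis-20195):
# thin rows LABELLED onto a down-closed monomial basis × ARBITRARY columns, every height

Helper file (`--supports stmt-ValiantsHypothesis-20195`; cell valiant-natproofs, rung V4, 𝒟-side of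
door (c); prover seat val-np-p7 gen 4).  Closes NO item; imports `…ChowThinRowsLeaveTwoOut`,
`…ChowThinRowsScaleChoice` (val-np-p7 g4) and prover g10's `…ChowThinRowsSubcubeBasis`
(`exists_forms_of_card_le`); no definitions.

**Theorem `chowHits_thinRows_of_labelling`** (the TRANSFER PRINCIPLE of memo
MEMO-CPM-pairlayer-pointers-v7 made a kernel theorem; lifts val-np-p8's union-labelling theorem from
down-closed columns to arbitrary columns).  Let the rows `u i ⊆ Fin h` have size `≤ 2` and let the
columns `w j` be ARBITRARY.  Suppose `U : Fin r → Finset (Fin h)` is an injective DOWN-CLOSED family with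
`det [U i ⊆ w j] ≠ 0` (a down-closed monomial basis of the columns — one always exists,
`exists_downClosed_monomialBasis`, p519239), and the `x`-variables carry LABELS `L a ⊆ Fin h` such that
`i ↦ ⋃_{a ∈ u i} L a` is a bijection onto the `U i'` (given as a permutation `π` with
`⋃_{a ∈ u i} L a = U (π i)`) and the two labels of a pair row are disjoint and distinct.  Then some
product of `h + h` affine forms has a nonsingular partition minor on this layout, at every height.

**The witness.**  Forms: `1 + y_c` for every `c`, and for every label `V = L a` the scaled indicator form
`1 + σ_V y_V + Σ_{a : L a = V} x_a` (`σ_V = 1` if `|V| ≤ 1`, else `ε` from `exists_good_scale`); at most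
`h + h` forms.  Row `u` of the partition matrix is then `[y^w](B · ∏_{a ∈ u} t_{L a})`
(`coeff_single_prod_label`, `coeff_pair_prod_label`, `coeff_leaveOneOutG`, `coeff_leaveTwoOutG`), the
products `∏_{a∈u} t_{L a}` are supported below `⋃ L a ∈ Δ` with nonzero top coefficient
(`coeff_tprod_eq_zero`, `coeff_tprod_top`), so `M = P · B̃_ε` with `P` triangular in `⊆` (invertible)
and `B̃_ε` invertible by `exists_good_scale`.

WHAT THIS IS NOT: layouts WITHOUT such a labelling (about half of the pair layer, e.g. rows
`{∅, a, ab}` against affinely independent columns) are not covered; items 20195 / 20172 / 19717 are NOT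
proved; nothing on crux stmt-ValiantsHypothesis-14610 or `VP` versus `VNP`.
-/

set_option linter.dupNamespace false

namespace Summit.ValiantsHypothesis.ValiantsHypothesis.Theorems.BarrierLever.ChowThinAll

open Finset MvPolynomial
open Summit.ValiantsHypothesis.ValiantsHypothesis.Theorems.BarrierLever.ChowFactor
  (coeff_partitionExpo_mul_affine coeff_partitionExpo_mul_yOnly totalDegree_affine_le)
open Summit.ValiantsHypothesis.ValiantsHypothesis.Theorems.BarrierLever.ProductStateSums
  (castAdd_ne_natAdd partitionExpo_apply_castAdd partitionExpo_apply_natAdd)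
open Summit.ValiantsHypothesis.ValiantsHypothesis.Theorems.BarrierLever.CorankRepair (partitionExpo_eq_iff)

/-- **Thin rows labelled onto a down-closed monomial basis × ARBITRARY columns, every height**: see the
module docstring.  (Rows `u i` of size `≤ 2`; `U` injective, down-closed, `det [U i ⊆ w j] ≠ 0`;
labels `L` with `⋃_{a ∈ u i} L a = U (π i)`, disjoint and distinct on pair rows.) -/
theorem chowHits_thinRows_of_labelling (h r : ℕ) (u w : Fin r → Finset (Fin h))
    (hu2 : ∀ i, (u i).card ≤ 2)
    (U : Fin r → Finset (Fin h)) (hUinj : Function.Injective U)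
    (hUdown : ∀ i (S : Finset (Fin h)), S ⊆ U i → ∃ i', U i' = S)
    (hZ : (Matrix.of fun i j : Fin r => if U i ⊆ w j then (1 : ℂ) else 0).det ≠ 0)
    (L : Fin h → Finset (Fin h)) (π : Fin r ≃ Fin r) (hπ : ∀ i, (u i).biUnion L = U (π i))
    (hdis : ∀ i, ∀ a ∈ u i, ∀ b ∈ u i, a ≠ b → Disjoint (L a) (L b) ∧ L a ≠ L b) :
    ∃ ℓ : Fin (h + h) → MvPolynomial (Fin (h + h)) ℂ, (∀ k, (ℓ k).totalDegree ≤ 1) ∧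
      (Matrix.of fun i j : Fin r => MvPolynomial.coeff
        (∑ a ∈ u i, Finsupp.single (Fin.castAdd h a) 1 +
          ∑ c ∈ w j, Finsupp.single (Fin.natAdd h c) 1) (∏ k, ℓ k)).det ≠ 0 := by
  classical
  -- Step 1: the index family of the forms: all singletons and all labels
  set S₁ : Finset (Finset (Fin h)) := (Finset.univ : Finset (Fin h)).image fun c => ({c} : Finset (Fin h))
    with hS₁
  set PT : Finset (Finset (Fin h)) := S₁ ∪ (Finset.univ : Finset (Fin h)).image L with hPT
  have hsing : ∀ c : Fin h, ({c} : Finset (Fin h)) ∈ PT := fun c =>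
    Finset.mem_union_left _ (Finset.mem_image.mpr ⟨c, Finset.mem_univ _, rfl⟩)
  have hLPT : ∀ a, L a ∈ PT := fun a =>
    Finset.mem_union_right _ (Finset.mem_image.mpr ⟨a, Finset.mem_univ _, rfl⟩)
  have hcard : PT.card ≤ h + h := by
    refine (Finset.card_union_le _ _).trans (Nat.add_le_add ?_ ?_) <;>
      exact Finset.card_image_le.trans (by rw [Finset.card_univ, Fintype.card_fin])
  -- Step 2: the scale
  obtain ⟨s, hs, hBt, -⟩ := exists_good_scale U w PT hsing hZ
  set γ : Finset (Fin h) → Fin h → ℂ :=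
    fun V c => (if V.card ≤ 1 then (1 : ℂ) else s) * (if c ∈ V then 1 else 0) with hγ
  have hγsupp : ∀ (V : Finset (Fin h)) (c : Fin h), c ∉ V → γ V c = 0 := by
    intro V c hc
    simp only [hγ, if_neg hc, mul_zero]
  have hγprod : ∀ V : Finset (Fin h), ∏ c ∈ V, γ V c ≠ 0 := by
    intro V
    refine Finset.prod_ne_zero_iff.mpr fun c hc => ?_
    simp only [hγ, if_pos hc, mul_one]
    split_ifs
    · exact one_ne_zero
    · exact hs
  set κ : Fin h → Finset (Fin h) → ℂ := fun a V => if V = L a then (1 : ℂ) else 0 with hκ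
  -- Step 3: the forms and their embedding into `Fin (h + h)`
  obtain ⟨ℓ, hℓdeg, hℓprod⟩ := ChowSubcube.exists_forms_of_card_le PT hcard
    (fun V => C 1 + ∑ a, C (κ a V) * X (Fin.castAdd h a) + ∑ c, C (γ V c) * X (Fin.natAdd h c))
    (fun V _ => by
      have e : (C 1 + ∑ a, C (κ a V) * X (Fin.castAdd h a) + ∑ c, C (γ V c) * X (Fin.natAdd h c) :
            MvPolynomial (Fin (h + h)) ℂ) =
          C 1 + ∑ v : Fin (h + h), C (Fin.append (fun a => κ a V) (fun c => γ V c) v) * X v := by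
        rw [Fin.sum_univ_add]
        simp only [Fin.append_left, Fin.append_right, add_assoc]
      rw [e]
      exact totalDegree_affine_le _ _)
  refine ⟨ℓ, hℓdeg, ?_⟩
  rw [hℓprod]
  -- abbreviations: the `y`-only product `B`, its coefficients `b`, the truncated inverses `t V`
  set B : MvPolynomial (Fin (h + h)) ℂ := ∏ V ∈ PT,
    (C 1 + ∑ a, C ((fun (_ : Fin h) (_ : Finset (Fin h)) => (0 : ℂ)) a V) * X (Fin.castAdd h a) +
      ∑ c, C (γ V c) * X (Fin.natAdd h c)) with hB
  obtain ⟨b, hb⟩ : ∃ b : Finset (Fin h) → ℂ, ∀ W', b W' = coeff (∑ a ∈ (∅ : Finset (Fin h)),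
      Finsupp.single (Fin.castAdd h a) 1 + ∑ c ∈ W', Finsupp.single (Fin.natAdd h c) 1) B :=
    ⟨fun W' => _, fun _ => rfl⟩
  set t : Finset (Fin h) → MvPolynomial (Fin (h + h)) ℂ := fun V =>
    ∑ U' ∈ V.powerset, monomial (∑ a ∈ (∅ : Finset (Fin h)), Finsupp.single (Fin.castAdd h a) 1 +
      ∑ c ∈ U', Finsupp.single (Fin.natAdd h c) 1)
      ((-1 : ℂ) ^ U'.card * (U'.card.factorial : ℂ) * ∏ c ∈ U', γ V c) with ht
  -- the row polynomials `ρ i = ∏_{a ∈ u i} t (L a)` and their coefficients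
  obtain ⟨ρ, hρ⟩ : ∃ ρ : Fin r → Finset (Fin h) → ℂ, ∀ i X', ρ i X' = coeff (∑ a ∈ (∅ : Finset (Fin h)),
      Finsupp.single (Fin.castAdd h a) 1 + ∑ c ∈ X', Finsupp.single (Fin.natAdd h c) 1)
        (∏ a ∈ u i, t (L a)) := ⟨fun i X' => _, fun _ _ => rfl⟩
  -- Step 4: every entry is `Σ_{X ⊆ w j} b (w j \ X) · ρ i X`
  have hcoeff1 : ∀ X' : Finset (Fin h), coeff (∑ a ∈ (∅ : Finset (Fin h)),
      Finsupp.single (Fin.castAdd h a) 1 + ∑ c ∈ X', Finsupp.single (Fin.natAdd h c) 1)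
      (1 : MvPolynomial (Fin (h + h)) ℂ) = if X' = ∅ then 1 else 0 := by
    intro X'
    rw [coeff_one]
    by_cases h0 : X' = ∅
    · subst h0; simp
    · rw [if_neg h0, if_neg]
      intro e
      exact h0 ((partitionExpo_eq_iff ∅ ∅ ∅ X').mp (by simpa using e)).2.symm
  have hentry : ∀ i j, coeff (∑ a ∈ u i, Finsupp.single (Fin.castAdd h a) 1 +
        ∑ c ∈ w j, Finsupp.single (Fin.natAdd h c) 1)
      (∏ V ∈ PT, (C 1 + ∑ a, C (κ a V) * X (Fin.castAdd h a) + ∑ c, C (γ V c) * X (Fin.natAdd h c))) =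
      ∑ X' ∈ (w j).powerset, b (w j \ X') * ρ i X' := by
    intro i j
    rcases Nat.lt_or_ge (u i).card 1 with h0 | h1
    · -- `u i = ∅`
      have hui : u i = ∅ := Finset.card_eq_zero.mp (by omega)
      have hterm : ∀ X' ∈ (w j).powerset, b (w j \ X') * ρ i X' = if X' = ∅ then b (w j \ X') else 0 := by
        intro X' _
        rw [hρ, hui, Finset.prod_empty, hcoeff1]
        split_ifs <;> simp
      rw [Finset.sum_congr rfl hterm, Finset.sum_ite_eq', if_pos (Finset.empty_mem_powerset _),
        Finset.sdiff_empty, hb, hui]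
      exact coeff_empty_prod_eqG κ (fun _ _ => (0 : ℂ)) γ PT (w j)
    rcases Nat.lt_or_ge (u i).card 2 with h1' | h2
    · -- `u i = {a}`
      have hc1 : (u i).card = 1 := by omega
      obtain ⟨a, ha⟩ := Finset.card_eq_one.mp hc1
      rw [ha, coeff_single_prod_label L γ PT a (hLPT a) (w j),
        coeff_leaveOneOutG γ PT (L a) (hLPT a) (hγsupp (L a)) (w j)]
      refine Finset.sum_congr rfl fun X' _ => ?_
      rw [hb, hρ, ha, Finset.prod_singleton]
    · -- `u i = {a, a'}`
      obtain ⟨a, a', haa', hia⟩ := Finset.card_eq_two.mp (le_antisymm (hu2 i) h2)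
      have hd := hdis i a (by rw [hia]; simp) a' (by rw [hia]; simp) haa'
      rw [hia, coeff_pair_prod_label L γ PT haa' (hLPT a) (hLPT a') hd.2 (w j),
        coeff_leaveTwoOutG γ PT (L a) (L a') (hLPT a) (hLPT a') hd.2 (hγsupp (L a)) (hγsupp (L a')) (w j)]
      refine Finset.sum_congr rfl fun X' _ => ?_
      rw [hb, hρ, hia, Finset.prod_pair haa']
  -- Step 5: support and top coefficient of the row polynomials
  have hsupp : ∀ i (X' : Finset (Fin h)), ρ i X' ≠ 0 → X' ⊆ U (π i) := by
    intro i X' hX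
    rw [← hπ i]
    rcases Nat.lt_or_ge (u i).card 1 with h0 | h1
    · have hui : u i = ∅ := Finset.card_eq_zero.mp (by omega)
      rw [hρ, hui, Finset.prod_empty, hcoeff1] at hX
      by_cases hx0 : X' = ∅
      · rw [hx0]; exact Finset.empty_subset _
      · exact absurd (if_neg hx0) hX
    rcases Nat.lt_or_ge (u i).card 2 with h1' | h2
    · have hc1 : (u i).card = 1 := by omega
      obtain ⟨a, ha⟩ := Finset.card_eq_one.mp hc1
      rw [ha, Finset.singleton_biUnion]
      by_contra hsub
      apply hX
      rw [hρ, ha, Finset.prod_singleton, ht, coeff_tinvG, if_neg hsub]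
    · obtain ⟨a, a', haa', hia⟩ := Finset.card_eq_two.mp (le_antisymm (hu2 i) h2)
      rw [hρ, hia, Finset.prod_pair haa'] at hX
      have hbi : ({a, a'} : Finset (Fin h)).biUnion L = L a ∪ L a' := by
        rw [Finset.biUnion_insert, Finset.singleton_biUnion]
      rw [hia, hbi]
      by_contra hsub
      exact hX (coeff_tprod_eq_zero γ (L a) (L a') X' hsub)
  have htop : ∀ i, ρ i (U (π i)) ≠ 0 := by
    intro i
    rw [← hπ i]
    rcases Nat.lt_or_ge (u i).card 1 with h0 | h1
    · have hui : u i = ∅ := Finset.card_eq_zero.mp (by omega)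
      rw [hρ, hui, Finset.prod_empty, Finset.biUnion_empty, hcoeff1, if_pos rfl]
      exact one_ne_zero
    rcases Nat.lt_or_ge (u i).card 2 with h1' | h2
    · have hc1 : (u i).card = 1 := by omega
      obtain ⟨a, ha⟩ := Finset.card_eq_one.mp hc1
      rw [hρ, ha, Finset.prod_singleton, Finset.singleton_biUnion, ht, coeff_tinvG, if_pos (subset_refl _)]
      exact mul_ne_zero (mul_ne_zero (pow_ne_zero _ (by norm_num))
        (by exact_mod_cast (L a).card.factorial_ne_zero)) (hγprod (L a))
    · obtain ⟨a, a', haa', hia⟩ := Finset.card_eq_two.mp (le_antisymm (hu2 i) h2)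
      have hd := hdis i a (by rw [hia]; simp) a' (by rw [hia]; simp) haa'
      have hbi : ({a, a'} : Finset (Fin h)).biUnion L = L a ∪ L a' := by
        rw [Finset.biUnion_insert, Finset.singleton_biUnion]
      rw [hρ, hia, Finset.prod_pair haa', hbi, ht, coeff_tprod_top γ (L a) (L a') hd.1]
      refine mul_ne_zero ?_ ?_
      · exact mul_ne_zero (mul_ne_zero (pow_ne_zero _ (by norm_num))
          (by exact_mod_cast (L a).card.factorial_ne_zero)) (hγprod (L a))
      · exact mul_ne_zero (mul_ne_zero (pow_ne_zero _ (by norm_num))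
          (by exact_mod_cast (L a').card.factorial_ne_zero)) (hγprod (L a'))
  -- Step 6: the factorisation `M = P · B̃`
  set P : Matrix (Fin r) (Fin r) ℂ := Matrix.of fun i i' => ρ i (U i') with hP
  set Bt : Matrix (Fin r) (Fin r) ℂ := Matrix.of fun i' j => if U i' ⊆ w j then b (w j \ U i') else 0
    with hBtdef
  have hfact : (Matrix.of fun i j : Fin r => MvPolynomial.coeff
      (∑ a ∈ u i, Finsupp.single (Fin.castAdd h a) 1 + ∑ c ∈ w j, Finsupp.single (Fin.natAdd h c) 1)
      (∏ V ∈ PT, (C 1 + ∑ a, C (κ a V) * X (Fin.castAdd h a) + ∑ c, C (γ V c) * X (Fin.natAdd h c)))) =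
      P * Bt := by
    ext i j
    rw [Matrix.of_apply, hentry i j, Matrix.mul_apply]
    simp only [hP, hBtdef, Matrix.of_apply, mul_ite, mul_zero]
    -- reindex: the powerset sum is supported on the image of `U`
    have e1 : ∑ i', (if U i' ⊆ w j then ρ i (U i') * b (w j \ U i') else 0) =
        ∑ X' ∈ (Finset.univ : Finset (Fin r)).image U,
          (if X' ⊆ w j then ρ i X' * b (w j \ X') else 0) := by
      rw [Finset.sum_image (fun i₁ _ i₂ _ e => hUinj e)]
    have e2 : ∑ X' ∈ (Finset.univ : Finset (Fin r)).image U,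
          (if X' ⊆ w j then ρ i X' * b (w j \ X') else 0) =
        ∑ X' ∈ ((Finset.univ : Finset (Fin r)).image U).filter (fun X' => X' ⊆ w j),
          ρ i X' * b (w j \ X') := by
      rw [Finset.sum_filter]
    have e3 : ((Finset.univ : Finset (Fin r)).image U).filter (fun X' => X' ⊆ w j) =
        (w j).powerset.filter (fun X' => ∃ i', U i' = X') := by
      ext X'
      simp only [Finset.mem_filter, Finset.mem_image, Finset.mem_univ, true_and, Finset.mem_powerset]
      exact and_comm
    have e4 : ∑ X' ∈ (w j).powerset.filter (fun X' => ∃ i', U i' = X'), ρ i X' * b (w j \ X') =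
        ∑ X' ∈ (w j).powerset, b (w j \ X') * ρ i X' := by
      rw [Finset.sum_filter_of_ne]
      · exact Finset.sum_congr rfl fun X' _ => mul_comm _ _
      · intro X' _ hne
        have hX : ρ i X' ≠ 0 := fun e => hne (by rw [e, zero_mul])
        exact hUdown (π i) X' (hsupp i X' hX)
    rw [e1, e2, e3, e4]
  -- Step 7: `P` is invertible (triangular in `⊆` along `π`), `B̃` is invertible (choice of the scale)
  have hPinj : Function.Injective fun v => Matrix.vecMul v P := by
    intro c₁ c₂ hc
    rw [← sub_eq_zero]
    set c := c₁ - c₂ with hcdef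
    have h0 : ∀ i', ∑ i, c i * ρ i (U i') = 0 := by
      intro i'
      have e := congr_fun hc i'
      simp only [Matrix.vecMul, dotProduct, hP, Matrix.of_apply] at e
      simp only [hcdef, Pi.sub_apply, sub_mul, Finset.sum_sub_distrib]
      exact sub_eq_zero.mpr e
    -- downward induction on `|U (π i)|`
    have hind : ∀ n : ℕ, ∀ i, h - (U (π i)).card = n → c i = 0 := by
      intro n
      induction n using Nat.strong_induction_on with
      | _ n ih =>
        intro i hn
        have hsum := h0 (π i)
        rw [← Finset.add_sum_erase _ _ (Finset.mem_univ i)] at hsum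
        have hrest : ∑ i₂ ∈ (Finset.univ : Finset (Fin r)).erase i, c i₂ * ρ i₂ (U (π i)) = 0 := by
          refine Finset.sum_eq_zero fun i₂ hi₂ => ?_
          have hne : i₂ ≠ i := (Finset.mem_erase.mp hi₂).1
          by_cases hz : ρ i₂ (U (π i)) = 0
          · rw [hz, mul_zero]
          · have hsub : U (π i) ⊆ U (π i₂) := hsupp i₂ _ hz
            have hne' : U (π i) ≠ U (π i₂) := fun e => hne (π.injective (hUinj e)).symm
            have hlt : (U (π i)).card < (U (π i₂)).card :=
              Finset.card_lt_card (lt_of_le_of_ne hsub hne')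
            have hle : (U (π i₂)).card ≤ h := by simpa using Finset.card_le_univ (U (π i₂))
            rw [ih (h - (U (π i₂)).card) (by omega) i₂ rfl, zero_mul]
        rw [hrest, add_zero] at hsum
        exact (mul_eq_zero.mp hsum).resolve_right (htop i)
    funext i
    exact hind _ i rfl
  have hPdet : P.det ≠ 0 := by
    have hu := Matrix.vecMul_injective_iff_isUnit.mp hPinj
    exact ((Matrix.isUnit_iff_isUnit_det _).mp hu).ne_zero
  have hBt' : Bt.det ≠ 0 := by
    have e : Bt = Matrix.of fun i j : Fin r => if U i ⊆ w j then
        coeff (∑ a ∈ (∅ : Finset (Fin h)), Finsupp.single (Fin.castAdd h a) 1 +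
            ∑ c ∈ w j \ U i, Finsupp.single (Fin.natAdd h c) 1) B else 0 := by
      ext i j
      rw [hBtdef, Matrix.of_apply, Matrix.of_apply]
      split_ifs
      · exact hb _
      · rfl
    rw [e]
    exact hBt
  rw [hfact, Matrix.det_mul]
  exact mul_ne_zero hPdet hBt'

end Summit.ValiantsHypothesis.ValiantsHypothesis.Theorems.BarrierLever.ChowThinAll
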